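import Summits.Ventures.PercRepro.S2BasesTriangles

/-!
# PercRepro — S2: THE TRIANGLES THROUGH A POINT OF A SPREAD CORE (p7, gen 12; sub-claim S2; the cell `(15, 6)`)

On a spread core (every set of `≤ 9` points has nullity `≤ 3`) no point lies on four triangles: two distinct triangles of a core
share at most one point (`S2.five_le_ncard_union_of_triangles`), so four triangles through `x` cover exactly `9` points, and their
union has rank `≤ 5` (each line through `x` adds at most one to the rank: submodularity with `ρ({x}) = 1`) — nullity `≥ 4`
(**`not_four_triangles_through`**). Hence a triangle meets at most `6` others (two more through each of its points), and with
`≥ 8` triangles every triangle has a DISJOINT triangle (**`exists_disjoint_triangle_of_eight`**): the cobasis charge of the cell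
`(15, 6)` then reads `C(18, 15) − C(15, 12) = 361` per triangle. Axioms: standard.
-/

open scoped Matroid

namespace PercRepro

namespace S2

open Set

variable {α : Type}

/-- **A line through a point adds at most one to the rank**: for `x ∈ A ∩ T` a nonloop and `ρ(T) ≤ 2`, `ρ(A ∪ T) ≤ ρ(A) + 1`. -/
theorem eRk_union_le_add_one_of_mem (M : Matroid α) {A T : Set α} {x : α} (hx : M.IsNonloop x)
    (hxA : x ∈ A) (hxT : x ∈ T) (hT : M.eRk T ≤ 2) : M.eRk (A ∪ T) ≤ M.eRk A + 1 := by
  have h := M.eRk_inter_add_eRk_union_le A T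
  have h1 : (1 : ℕ∞) ≤ M.eRk (A ∩ T) := by
    rw [← hx.eRk_eq]
    exact M.eRk_mono (Set.singleton_subset_iff.2 ⟨hxA, hxT⟩)
  have h2 : M.eRk (A ∪ T) + 1 ≤ (M.eRk A + 1) + 1 := by
    calc M.eRk (A ∪ T) + 1 ≤ M.eRk (A ∪ T) + M.eRk (A ∩ T) := by gcongr
      _ = M.eRk (A ∩ T) + M.eRk (A ∪ T) := add_comm _ _
      _ ≤ M.eRk A + M.eRk T := h
      _ ≤ M.eRk A + 2 := by gcongr
      _ = (M.eRk A + 1) + 1 := by rw [add_assoc]; rfl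
  exact (ENat.add_le_add_iff_right (by simp)).1 h2

/-- **No four triangles through a point** on a spread core (every set of `≤ 9` points has nullity `≤ 3`). -/
theorem not_four_triangles_through (M : Matroid α) [M.Finite]
    (hC1 : ∀ L ⊆ M.E, M.eRk L = 2 → L.ncard ≤ 3)
    (h9 : ∀ X ⊆ M.E, X.ncard ≤ 9 → X.encard ≤ M.eRk X + 3)
    {x : α} {T₁ T₂ T₃ T₄ : Set α}
    (h₁ : M.IsCircuit T₁) (h₁c : T₁.ncard = 3) (hx₁ : x ∈ T₁)
    (h₂ : M.IsCircuit T₂) (h₂c : T₂.ncard = 3) (hx₂ : x ∈ T₂)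
    (h₃ : M.IsCircuit T₃) (h₃c : T₃.ncard = 3) (hx₃ : x ∈ T₃)
    (h₄ : M.IsCircuit T₄) (h₄c : T₄.ncard = 3) (hx₄ : x ∈ T₄)
    (h12 : T₁ ≠ T₂) (h13 : T₁ ≠ T₃) (h14 : T₁ ≠ T₄) (h23 : T₂ ≠ T₃) (h24 : T₂ ≠ T₄) (h34 : T₃ ≠ T₄) : False := by
  classical
  have hfin : ∀ {T : Set α}, M.IsCircuit T → T.Finite := fun hT => M.ground_finite.subset hT.subset_ground
  -- two distinct triangles through `x` meet exactly in `{x}`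
  have hmeet : ∀ {T T' : Set α}, M.IsCircuit T → T.ncard = 3 → x ∈ T → M.IsCircuit T' → T'.ncard = 3 → x ∈ T' →
      T ≠ T' → T ∩ T' = {x} := by
    intro T T' hT hTc hxT hT' hT'c hxT' hne
    have hu := five_le_ncard_union_of_triangles M hC1 hT hTc hT' hT'c hne
    have hi := Set.ncard_union_add_ncard_inter T T' (hfin hT) (hfin hT')
    have hle : (T ∩ T').ncard ≤ ({x} : Set α).ncard := by
      rw [Set.ncard_singleton]; omega
    exact (Set.eq_of_subset_of_ncard_le (Set.singleton_subset_iff.2 (Set.mem_inter hxT hxT')) hle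
      ((hfin hT).subset Set.inter_subset_left)).symm
  -- the rank of a triangle is `2`
  have hrk : ∀ {T : Set α}, M.IsCircuit T → T.ncard = 3 → M.eRk T ≤ 2 := by
    intro T hT hTc
    have h := hT.eRk_add_one_eq
    rw [← (hfin hT).cast_ncard_eq, hTc] at h
    have h' : M.eRk T + 1 ≤ 2 + 1 := by rw [h]; norm_num
    exact (ENat.add_le_add_iff_right (by simp)).1 h'
  have hx : M.IsNonloop x := h₁.isNonloop_of_mem_of_one_lt_card (by
    rw [← (hfin h₁).cast_ncard_eq, h₁c]; norm_num) hx₁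
  -- the sizes: `|T₁ ∪ T₂| = 5`, `|T₁ ∪ T₂ ∪ T₃| = 7`, `|T₁ ∪ T₂ ∪ T₃ ∪ T₄| = 9`
  have hi12 := hmeet h₁ h₁c hx₁ h₂ h₂c hx₂ h12
  have hi13 := hmeet h₁ h₁c hx₁ h₃ h₃c hx₃ h13
  have hi23 := hmeet h₂ h₂c hx₂ h₃ h₃c hx₃ h23
  have hi14 := hmeet h₁ h₁c hx₁ h₄ h₄c hx₄ h14
  have hi24 := hmeet h₂ h₂c hx₂ h₄ h₄c hx₄ h24
  have hi34 := hmeet h₃ h₃c hx₃ h₄ h₄c hx₄ h34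
  have hu12 := Set.ncard_union_add_ncard_inter T₁ T₂ (hfin h₁) (hfin h₂)
  rw [hi12, Set.ncard_singleton, h₁c, h₂c] at hu12
  have hu123 := Set.ncard_union_add_ncard_inter (T₁ ∪ T₂) T₃ ((hfin h₁).union (hfin h₂)) (hfin h₃)
  rw [Set.union_inter_distrib_right, hi13, hi23, Set.union_self, Set.ncard_singleton, h₃c] at hu123
  have hu1234 := Set.ncard_union_add_ncard_inter (T₁ ∪ T₂ ∪ T₃) T₄
    (((hfin h₁).union (hfin h₂)).union (hfin h₃)) (hfin h₄)
  rw [Set.union_inter_distrib_right, Set.union_inter_distrib_right, hi14, hi24, hi34, Set.union_self,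
    Set.union_self, Set.ncard_singleton, h₄c] at hu1234
  -- the ranks: `≤ 3`, `≤ 4`, `≤ 5`
  have hr12 : M.eRk (T₁ ∪ T₂) ≤ 2 + 1 := by
    have := eRk_union_le_add_one_of_mem M hx hx₁ hx₂ (hrk h₂ h₂c)
    have h1 := hrk h₁ h₁c
    calc M.eRk (T₁ ∪ T₂) ≤ M.eRk T₁ + 1 := this
      _ ≤ 2 + 1 := by gcongr
  have hr123 : M.eRk (T₁ ∪ T₂ ∪ T₃) ≤ 2 + 1 + 1 := by
    have := eRk_union_le_add_one_of_mem M hx (A := T₁ ∪ T₂) (Set.mem_union_left _ hx₁) hx₃ (hrk h₃ h₃c)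
    calc M.eRk (T₁ ∪ T₂ ∪ T₃) ≤ M.eRk (T₁ ∪ T₂) + 1 := this
      _ ≤ 2 + 1 + 1 := by gcongr
  have hr1234 : M.eRk (T₁ ∪ T₂ ∪ T₃ ∪ T₄) ≤ 2 + 1 + 1 + 1 := by
    have := eRk_union_le_add_one_of_mem M hx (A := T₁ ∪ T₂ ∪ T₃) (Set.mem_union_left _ (Set.mem_union_left _ hx₁)) hx₄ (hrk h₄ h₄c)
    calc M.eRk (T₁ ∪ T₂ ∪ T₃ ∪ T₄) ≤ M.eRk (T₁ ∪ T₂ ∪ T₃) + 1 := this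
      _ ≤ 2 + 1 + 1 + 1 := by gcongr
  -- the spread bound on the `9`-point union
  have hV : T₁ ∪ T₂ ∪ T₃ ∪ T₄ ⊆ M.E :=
    Set.union_subset (Set.union_subset (Set.union_subset h₁.subset_ground h₂.subset_ground) h₃.subset_ground)
      h₄.subset_ground
  have hVfin : (T₁ ∪ T₂ ∪ T₃ ∪ T₄).Finite := M.ground_finite.subset hV
  have hV9 : (T₁ ∪ T₂ ∪ T₃ ∪ T₄).ncard = 9 := by omega
  have h := h9 _ hV (by omega)
  rw [← hVfin.cast_ncard_eq, hV9] at h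
  have h' : (9 : ℕ∞) ≤ 2 + 1 + 1 + 1 + 3 := by
    calc (9 : ℕ∞) ≤ M.eRk (T₁ ∪ T₂ ∪ T₃ ∪ T₄) + 3 := h
      _ ≤ 2 + 1 + 1 + 1 + 3 := by gcongr
  norm_num at h'

/-- **With `≥ 8` triangles every triangle has a disjoint one** on a spread core: at most two other triangles pass through each
of its three points. -/
theorem exists_disjoint_triangle_of_eight (M : Matroid α) [M.Finite]
    (hC1 : ∀ L ⊆ M.E, M.eRk L = 2 → L.ncard ≤ 3)
    (h9 : ∀ X ⊆ M.E, X.ncard ≤ 9 → X.encard ≤ M.eRk X + 3)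
    (h8 : 8 ≤ {C : Set α | M.IsCircuit C ∧ C.ncard = 3}.ncard)
    {T : Set α} (hT : M.IsCircuit T) (hT3 : T.ncard = 3) :
    ∃ T' : Set α, M.IsCircuit T' ∧ T'.ncard = 3 ∧ Disjoint T' T := by
  classical
  set 𝒯 := {C : Set α | M.IsCircuit C ∧ C.ncard = 3} with h𝒯
  have h𝒯fin : 𝒯.Finite := M.ground_finite.finite_subsets.subset (fun C hC => hC.1.subset_ground)
  by_contra hcon
  push Not at hcon
  -- every other triangle meets `T`, in exactly one point
  have hmeets : ∀ T' ∈ 𝒯, T' ≠ T → ∃ x ∈ T, x ∈ T' := by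
    intro T' hT' hne
    have := hcon T' hT'.1 hT'.2
    rw [Set.not_disjoint_iff] at this
    obtain ⟨x, hx', hx⟩ := this
    exact ⟨x, hx, hx'⟩
  -- the triangles through a point `x ∈ T` other than `T`: at most `2`
  have hthrough : ∀ x ∈ T, ({T' ∈ 𝒯 | T' ≠ T ∧ x ∈ T'} : Set (Set α)).ncard ≤ 2 := by
    intro x hxT
    by_contra hlt
    push Not at hlt
    obtain ⟨T₂, T₃, T₄, h2, h3, h4, h23, h24, h34⟩ := (Set.two_lt_ncard_iff (h𝒯fin.subset (fun C hC => hC.1))).1 hlt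
    exact not_four_triangles_through M hC1 h9 hT hT3 hxT h2.1.1 h2.1.2 h2.2.2 h3.1.1 h3.1.2 h3.2.2
      h4.1.1 h4.1.2 h4.2.2 (Ne.symm h2.2.1) (Ne.symm h3.2.1) (Ne.symm h4.2.1) h23 h24 h34
  -- `𝒯 ∖ {T} ⊆ ⋃_{x ∈ T} (triangles through x other than T)`
  have hcover : 𝒯 \ {T} ⊆ ⋃ x ∈ T, ({T' ∈ 𝒯 | T' ≠ T ∧ x ∈ T'} : Set (Set α)) := by
    rintro T' ⟨hT'𝒯, hne⟩
    rw [Set.mem_singleton_iff] at hne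
    obtain ⟨x, hxT, hxT'⟩ := hmeets T' hT'𝒯 hne
    have hmem : T' ∈ ({T' ∈ 𝒯 | T' ≠ T ∧ x ∈ T'} : Set (Set α)) := ⟨hT'𝒯, hne, hxT'⟩
    exact Set.mem_iUnion₂.2 ⟨x, hxT, hmem⟩
  have hTfin : T.Finite := M.ground_finite.subset hT.subset_ground
  have hsum : (⋃ x ∈ T, ({T' ∈ 𝒯 | T' ≠ T ∧ x ∈ T'} : Set (Set α))).ncard ≤ 6 := by
    have hT' : (⋃ x ∈ T, ({T' ∈ 𝒯 | T' ≠ T ∧ x ∈ T'} : Set (Set α))) =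
        ⋃ x ∈ hTfin.toFinset, ({T' ∈ 𝒯 | T' ≠ T ∧ x ∈ T'} : Set (Set α)) := by
      simp only [Set.Finite.mem_toFinset]
    rw [hT']
    refine (Finset.set_ncard_biUnion_le hTfin.toFinset _).trans ?_
    calc ∑ x ∈ hTfin.toFinset, ({T' ∈ 𝒯 | T' ≠ T ∧ x ∈ T'} : Set (Set α)).ncard
        ≤ ∑ _x ∈ hTfin.toFinset, 2 := Finset.sum_le_sum (fun x hx => hthrough x ((Set.Finite.mem_toFinset hTfin).1 hx))
      _ = 6 := by
        rw [Finset.sum_const, smul_eq_mul, ← Set.ncard_eq_toFinset_card T hTfin, hT3]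
  have hT𝒯 : T ∈ 𝒯 := ⟨hT, hT3⟩
  have hdiff : (𝒯 \ {T}).ncard = 𝒯.ncard - 1 := by
    rw [Set.ncard_sdiff (Set.singleton_subset_iff.2 hT𝒯) (Set.finite_singleton T), Set.ncard_singleton]
  have hle := Set.ncard_le_ncard hcover (h𝒯fin.subset (fun C hC => by
    obtain ⟨x, -, hC⟩ := Set.mem_iUnion₂.1 hC
    exact hC.1))
  omega

end S2

end PercRepro
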